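import Literature.NumberTheory.Irrationality.Hata1993.IrrationalityMeasure
import Summits.KontsevichZagierPeriods.Zeta5Search.MeasureHata
import HarnessLib

/-!
# ζ(5) search — Hata's measure lemma with GROWTH BRACKETS instead of a limit (cell `pub-zeta5`, PROVER 3)

HONEST FRAMING: systematic search; no irrationality claim unless certified.

`MeasureHata.lean` (on top of the literature seat's `Hata1993.remark_2_1`) needs the EXACT LIMIT
`log|qₙ|/n → Q` of the integer coefficients. What the cell's kernel tools deliver cheaply are BRACKETS:
`e^{(Q₁−δ)n} ≤ |qₙ| ≤ e^{(Q₂+δ)n}` eventually, for every `δ > 0` — e.g. the entropy bounds of a one-signed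
binomial sum (`Certificates/BinomialSumBounds`, `RecordRayGrowth{,Upper}`: `[85.0519, 85.08768884]` on the
record ray) or the ratio boxes of FORMAT A. Hata's argument (Acta Arith. 63 (1993), proof of Lemma 2.1 —
the tree's `Hata1993.log_lower_bound_core`, which is ALREADY stated with an upper rate `a`, a lower rate `b`
and a decay rate `t`) goes through verbatim with brackets, at the price of the gap `g = Q₂ − Q₁` in the
denominator. OUR generalisation (Summit side), all PROVED:

* `hasIrrationalityMeasure_of_brackets` — `γ ∉ ℚ`; for every `δ > 0`, eventually
  `e^{(Q₁−δ)n} ≤ |qₙ| ≤ e^{(Q₂+δ)n}` and `|qₙγ − pₙ| ≤ e^{−(σ−δ)n}`; `Q₁ ≤ Q₂`, `0 < Q₂`, `Q₂ − Q₁ < σ`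
  ⇒ `HasIrrationalityMeasure γ (1 + Q₂/(σ − (Q₂ − Q₁)))` (Hata's definition; for `Q₁ = Q₂` this is
  `remark_2_1`). No non-vanishing / non-proportionality hypothesis.
* `ExponentLE.of_bracket_rates` — the same in the `ExponentLE` (`¬ LiouvilleWith`) vocabulary of
  `MeasureRecords.lean`; `ExponentLE.of_bracket_bounds` — from eventual bounds with constants
  `k₁ e^{Q₁ n} ≤ |qₙ| ≤ k₂ e^{Q₂ n}`, `|qₙ ξ − pₙ| ≤ l e^{−σ n}` (the shape `RecordRayGrowth` / FORMAT A produce).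
* `irrational_and_exponentLE_of_bracket_bounds` — with `qₙξ − pₙ ≠ 0` infinitely often supplying `ξ ∉ ℚ`.

So a family with PROVED brackets `[Q₁, Q₂]` for its coefficients and a PROVED decay rate `σ > Q₂ − Q₁` has the
kernel exponent `μ(ξ) ≤ 1 + Q₂/(σ − Q₂ + Q₁)`; the loss against the limit version is second order in the
bracket width. Everything is PROVED (0 sorry, no named fact).
-/

noncomputable section

open Filter Topology
open Literature.NumberTheory.Irrationality.Hata1993

namespace Summit.KontsevichZagierPeriods.Zeta5Search

/-- **Hata's lemma with growth brackets.** Let `γ` be irrational and `pₙ, qₙ` integers such that for every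
`δ > 0`, for all large `n`: `e^{(Q₁−δ)n} ≤ |qₙ| ≤ e^{(Q₂+δ)n}` and `|qₙγ − pₙ| ≤ e^{−(σ−δ)n}`, where
`Q₁ ≤ Q₂`, `0 < Q₂` and `Q₂ − Q₁ < σ`. Then `γ` has an irrationality measure `1 + Q₂/(σ − (Q₂ − Q₁))` in
Hata's sense. (Proof = Hata's, via the tree's `log_lower_bound_core` with `a = Q₂+δ`, `b = Q₁−δ`,
`t = σ−δ`.) -/
theorem hasIrrationalityMeasure_of_brackets {γ Q₁ Q₂ σ : ℝ} (hγ : Irrational γ) (hQ₁₂ : Q₁ ≤ Q₂) (hQ₂ : 0 < Q₂) (hgap : Q₂ - Q₁ < σ) (p q : ℕ → ℤ)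
    (hq : ∀ δ : ℝ, 0 < δ → ∀ᶠ n : ℕ in atTop,
      Real.exp ((Q₁ - δ) * n) ≤ |(q n : ℝ)| ∧ |(q n : ℝ)| ≤ Real.exp ((Q₂ + δ) * n))
    (herr : ∀ δ : ℝ, 0 < δ → ∀ᶠ n : ℕ in atTop, |(q n : ℝ) * γ - p n| ≤ Real.exp (-((σ - δ) * n))) :
    HasIrrationalityMeasure γ (1 + Q₂ / (σ - (Q₂ - Q₁))) := by
  intro ε hε
  set g := σ - (Q₂ - Q₁) with hg_def
  have hg : 0 < g := by rw [hg_def]; linarith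
  -- δ = δ(ε) with (Q₂+δ)/(g-3δ) ≤ Q₂/g + ε/2 =: κ and δ ≤ g/7
  set κ := Q₂ / g + ε / 2 with hκ_def
  obtain ⟨δ, hδpos, hδg, hδslope⟩ := exists_delta hQ₂ hg hε
  set a := Q₂ + δ with ha_def
  set b := Q₁ - δ with hb_def
  set t := σ - δ with ht_def
  have hσ : 0 < σ := by linarith
  have ha : 0 < a := by positivity
  have ht : 0 < t := by rw [ht_def]; linarith
  have hs : a < b + t := by rw [ha_def, hb_def, ht_def]; linarith
  have hsa : 0 < b + t - a := by linarith
  have hslope : a / (b + t - a) ≤ κ := by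
    have : b + t - a = g - 3 * δ := by rw [ha_def, hb_def, ht_def, hg_def]; ring
    rw [this, ha_def]; exact hδslope
  obtain ⟨N₀, hN₀⟩ := eventually_atTop.1 ((hq δ hδpos).and (herr δ hδpos))
  set K := coreConst a b t with hK_def
  have hK0 : 0 ≤ K := coreConst_nonneg ha ht
  obtain ⟨q₀, hq₀⟩ := exists_nat_gt (max (Real.exp (t * (N₀ + 1))) (Real.exp (2 * K / ε)))
  have hq₀exp1 : Real.exp (t * (N₀ + 1)) < q₀ := lt_of_le_of_lt (le_max_left _ _) hq₀
  have hq₀exp2 : Real.exp (2 * K / ε) < q₀ := lt_of_le_of_lt (le_max_right _ _) hq₀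
  have hq₀pos : 0 < q₀ := by
    have : (0 : ℝ) < q₀ := lt_trans (Real.exp_pos _) hq₀exp1
    exact_mod_cast this
  refine ⟨q₀, hq₀pos, fun p' q' hq' => ?_⟩
  have hH1 : (q₀ : ℝ) ≤ (q' : ℝ) := by exact_mod_cast hq'
  have hHpos : (0 : ℝ) < q' := lt_of_lt_of_le (by exact_mod_cast hq₀pos) hH1
  have hHge1 : (1 : ℝ) ≤ q' := by exact_mod_cast (show (1 : ℤ) ≤ q' by omega)
  set Λ := (q' : ℝ) * γ - p' with hΛ_def
  have hq'ne : q' ≠ 0 := by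
    rintro rfl; simp at hHpos
  have hΛ : Λ ≠ 0 := by
    intro h0
    have : γ = (p' : ℝ) / q' := by
      rw [eq_div_iff hHpos.ne']
      rw [hΛ_def] at h0; linarith
    exact (irrational_iff_ne_rational γ).1 hγ p' q' hq'ne this
  have hΛpos : 0 < |Λ| := abs_pos.2 hΛ
  set A : ℕ → ℤ := fun n => q' * p n - p' * q n with hA_def
  set ω : ℕ → ℝ := fun n => (q' : ℝ) * ((q n : ℝ) * γ - p n) with hω_def
  have hid : ∀ n, N₀ ≤ n → (q n : ℝ) * Λ = A n + ω n := by
    intro n _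
    show (q n : ℝ) * ((q' : ℝ) * γ - p') =
      ((q' * p n - p' * q n : ℤ) : ℝ) + (q' : ℝ) * ((q n : ℝ) * γ - p n)
    push_cast; ring
  have hqb : ∀ n, N₀ ≤ n → Real.exp (b * n) ≤ |(q n : ℝ)| ∧ |(q n : ℝ)| ≤ Real.exp (a * n) :=
    fun n hn => (hN₀ n hn).1
  have hωb : ∀ n, N₀ ≤ n → |ω n| ≤ (q' : ℝ) * Real.exp (-(t * n)) := by
    intro n hn
    have h := (hN₀ n hn).2
    simp only [hω_def, abs_mul, abs_of_pos hHpos]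
    exact mul_le_mul_of_nonneg_left h hHpos.le
  have hΩ : ∀ n₁ : ℕ, ∃ n, n₁ ≤ n ∧ A n ≠ 0 :=
    exists_ne_zero_of_ne_zero hΛ hHpos (by linarith) (fun n hn => (hqb n hn).1) hωb hid
  have hthr : Real.exp (t * (N₀ + 1)) ≤ 4 * (q' : ℝ) := by linarith
  have hba : b ≤ a := by rw [ha_def, hb_def]; linarith
  have core := log_lower_bound_core hΛ hHge1 ha ht hs hba hqb hωb hid hΩ hthr
  have hlogH : 0 ≤ Real.log (q' : ℝ) := Real.log_nonneg hHge1
  have hlogHK : 2 * K / ε ≤ Real.log (q' : ℝ) := by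
    have := Real.log_le_log (Real.exp_pos _) (hq₀exp2.le.trans hH1)
    rwa [Real.log_exp] at this
  have h1 : -K - κ * Real.log (q' : ℝ) ≤ Real.log |Λ| := by
    have : a / (b + t - a) * Real.log (q' : ℝ) ≤ κ * Real.log (q' : ℝ) :=
      mul_le_mul_of_nonneg_right hslope hlogH
    linarith
  have hdiff : |γ - (p' : ℝ) / q'| = |Λ| / q' := by
    have : γ - (p' : ℝ) / q' = Λ / q' := by
      rw [hΛ_def, eq_div_iff hHpos.ne', sub_mul, div_mul_cancel₀ _ hHpos.ne']; ring
    rw [this, abs_div, abs_of_pos hHpos]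
  have h2 : -(1 + Q₂ / g + ε) * Real.log (q' : ℝ) ≤ Real.log |Λ| - Real.log (q' : ℝ) := by
    have hKε : K ≤ ε / 2 * Real.log (q' : ℝ) := by
      have := mul_le_mul_of_nonneg_left hlogHK (show (0 : ℝ) ≤ ε / 2 by linarith)
      rw [show ε / 2 * (2 * K / ε) = K by field_simp] at this
      exact this
    rw [hκ_def] at h1
    nlinarith
  rw [Real.rpow_def_of_pos hHpos, hdiff]
  have h3 : Real.log (q' : ℝ) * -(1 + Q₂ / g + ε) ≤ Real.log (|Λ| / q') := by
    rw [Real.log_div hΛpos.ne' hHpos.ne']; linarith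
  calc Real.exp (Real.log (q' : ℝ) * -(1 + Q₂ / g + ε))
      ≤ Real.exp (Real.log (|Λ| / q')) := Real.exp_le_exp.2 h3
    _ = |Λ| / q' := Real.exp_log (by positivity)

namespace ExponentLE

variable {ξ : ℝ}

/-- **C4 from growth BRACKETS (no limit, no non-proportionality).** `ξ ∉ ℚ`; for every `δ > 0`, eventually
`e^{(Q₁−δ)n} ≤ |qₙ| ≤ e^{(Q₂+δ)n}` and `|qₙξ − pₙ| ≤ e^{−(σ−δ)n}`; `Q₁ ≤ Q₂`, `0 < Q₂`, `Q₂ − Q₁ < σ`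
⇒ `μ(ξ) ≤ 1 + Q₂/(σ − (Q₂ − Q₁))`. -/
theorem of_bracket_rates {Q₁ Q₂ σ : ℝ} (hξ : Irrational ξ) (hQ₁₂ : Q₁ ≤ Q₂)
    (hQ₂ : 0 < Q₂) (hgap : Q₂ - Q₁ < σ) (p q : ℕ → ℤ)
    (hq : ∀ δ : ℝ, 0 < δ → ∀ᶠ n : ℕ in atTop,
      Real.exp ((Q₁ - δ) * n) ≤ |(q n : ℝ)| ∧ |(q n : ℝ)| ≤ Real.exp ((Q₂ + δ) * n))
    (herr : ∀ δ : ℝ, 0 < δ → ∀ᶠ n : ℕ in atTop, |(q n : ℝ) * ξ - p n| ≤ Real.exp (-((σ - δ) * n))) :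
    ExponentLE ξ (1 + Q₂ / (σ - (Q₂ - Q₁))) :=
  of_hasIrrationalityMeasure (hasIrrationalityMeasure_of_brackets hξ hQ₁₂ hQ₂ hgap p q hq herr)

/-- **The working form with constants.** `ξ ∉ ℚ`; eventually `k₁ e^{Q₁ n} ≤ |qₙ| ≤ k₂ e^{Q₂ n}` and
`|qₙξ − pₙ| ≤ l e^{−σ n}` (`k₁, k₂, l > 0`); `Q₁ ≤ Q₂`, `0 < Q₂`, `Q₂ − Q₁ < σ`
⇒ `μ(ξ) ≤ 1 + Q₂/(σ − (Q₂ − Q₁))`. -/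
theorem of_bracket_bounds {Q₁ Q₂ σ k₁ k₂ l : ℝ} (hξ : Irrational ξ) (hQ₁₂ : Q₁ ≤ Q₂)
    (hQ₂ : 0 < Q₂) (hgap : Q₂ - Q₁ < σ) (hk₁ : 0 < k₁) (hk₂ : 0 < k₂) (hl : 0 < l) (p q : ℕ → ℤ)
    (hlow : ∀ᶠ n : ℕ in atTop, k₁ * Real.exp (Q₁ * n) ≤ |(q n : ℝ)|)
    (hup : ∀ᶠ n : ℕ in atTop, |(q n : ℝ)| ≤ k₂ * Real.exp (Q₂ * n))
    (herr : ∀ᶠ n : ℕ in atTop, |(q n : ℝ) * ξ - p n| ≤ l * Real.exp (-(σ * n))) :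
    ExponentLE ξ (1 + Q₂ / (σ - (Q₂ - Q₁))) := by
  refine of_bracket_rates hξ hQ₁₂ hQ₂ hgap p q (fun δ hδ => ?_) (fun δ hδ => ?_)
  · -- absorb the constants: `k₁ ≥ e^{-δ n}` and `k₂ ≤ e^{δ n}` for large `n`
    have hδn : Tendsto (fun n : ℕ => δ * (n : ℝ)) atTop atTop :=
      tendsto_natCast_atTop_atTop.const_mul_atTop hδ
    filter_upwards [hlow, hup, hδn.eventually_ge_atTop (-Real.log k₁),
      hδn.eventually_ge_atTop (Real.log k₂)] with n h1 h2 h3 h4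
    constructor
    · refine le_trans ?_ h1
      have e : k₁ * Real.exp (Q₁ * n) = Real.exp (Real.log k₁ + Q₁ * n) := by
        rw [Real.exp_add, Real.exp_log hk₁]
      rw [e, Real.exp_le_exp]
      linarith
    · refine h2.trans ?_
      have e : k₂ * Real.exp (Q₂ * n) = Real.exp (Real.log k₂ + Q₂ * n) := by
        rw [Real.exp_add, Real.exp_log hk₂]
      rw [e, Real.exp_le_exp]
      linarith
  · have hδn : Tendsto (fun n : ℕ => δ * (n : ℝ)) atTop atTop :=
      tendsto_natCast_atTop_atTop.const_mul_atTop hδ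
    filter_upwards [herr, hδn.eventually_ge_atTop (Real.log l)] with n hn hlog
    refine hn.trans ?_
    have e : l * Real.exp (-(σ * n)) = Real.exp (Real.log l + -(σ * n)) := by
      rw [Real.exp_add, Real.exp_log hl]
    rw [e, Real.exp_le_exp]
    linarith

end ExponentLE

/-- **Irrationality AND the bracket exponent from one data set.** Eventual bounds
`k₁ e^{Q₁ n} ≤ |qₙ| ≤ k₂ e^{Q₂ n}`, `|qₙξ − pₙ| ≤ l e^{−σ n}` and `qₙξ − pₙ ≠ 0` infinitely often
(`Q₁ ≤ Q₂`, `0 < Q₂`, `Q₂ − Q₁ < σ`) give `ξ ∉ ℚ` and `μ(ξ) ≤ 1 + Q₂/(σ − (Q₂ − Q₁))`. -/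
theorem irrational_and_exponentLE_of_bracket_bounds {ξ Q₁ Q₂ σ k₁ k₂ l : ℝ} (hQ₁₂ : Q₁ ≤ Q₂) (hQ₂ : 0 < Q₂) (hgap : Q₂ - Q₁ < σ) (hk₁ : 0 < k₁) (hk₂ : 0 < k₂) (hl : 0 < l)
    (p q : ℕ → ℤ)
    (hlow : ∀ᶠ n : ℕ in atTop, k₁ * Real.exp (Q₁ * n) ≤ |(q n : ℝ)|)
    (hup : ∀ᶠ n : ℕ in atTop, |(q n : ℝ)| ≤ k₂ * Real.exp (Q₂ * n))
    (herr : ∀ᶠ n : ℕ in atTop, |(q n : ℝ) * ξ - p n| ≤ l * Real.exp (-(σ * n)))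
    (hne : ∃ᶠ n : ℕ in atTop, (q n : ℝ) * ξ - p n ≠ 0) :
    Irrational ξ ∧ ExponentLE ξ (1 + Q₂ / (σ - (Q₂ - Q₁))) := by
  have hσ : 0 < σ := by linarith
  have hξ : Irrational ξ := by
    refine irrational_of_int_linear_forms (fun n => -p n) q ?_ ?_
    · have h0 : Tendsto (fun n : ℕ => l * Real.exp (-(σ * n))) atTop (𝓝 0) := by
        have h1 : Tendsto (fun n : ℕ => Real.exp (-(σ * n))) atTop (𝓝 0) := by
          refine Real.tendsto_exp_atBot.comp ?_
          exact tendsto_neg_atTop_atBot.comp (tendsto_natCast_atTop_atTop.const_mul_atTop hσ)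
        simpa using h1.const_mul l
      refine squeeze_zero_norm' ?_ h0
      filter_upwards [herr] with n hn
      rw [Real.norm_eq_abs]
      have e : ((-p n : ℤ) : ℝ) + q n * ξ = (q n : ℝ) * ξ - p n := by push_cast; ring
      rw [e]
      exact hn
    · refine hne.mono fun n hn => ?_
      have e : ((-p n : ℤ) : ℝ) + q n * ξ = (q n : ℝ) * ξ - p n := by push_cast; ring
      rw [e]
      exact hn
  exact ⟨hξ, ExponentLE.of_bracket_bounds hξ hQ₁₂ hQ₂ hgap hk₁ hk₂ hl p q hlow hup herr⟩

end Summit.KontsevichZagierPeriods.Zeta5Search
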